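import Summits.NavierStokesRegularity.NavierStokesRegularity.Theorems.EfficiencyFloorRigidExitSliceGroup
import HarnessLib

/-!
# Route `EfficiencyFloor`, support `RigidExit` (stmt-25513) on the `ProductionEfficiencyDecay` ladder (stmt-22866):
# THE COMPACT-STABILISER SLICE — orbit tangent sequences admit representatives at rate `O(τₙ)`

Helper file (`--supports stmt-NavierStokesRegularity-22866`; line `efficiency_floor`), second half of the slice begun in
`…RigidExitSliceGroup`, settling the (RATE) residue of item (i) ORBIT SELECTION typed in `…RigidExitTangentConeRate` for sequences
already known to lie in ONE symmetry orbit (which is what clause (a) of `MaximiserSetRigidity` with `…OrbitClosed`/`…ScaleClock`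
provides). Setting: a continuous, differentiable profile `m : ℝ³ → ℝ³` vanishing at infinity and not identically zero; orbit points
`wₙ = λₙ Cₙ m(λₙ C'ₙ(· − aₙ))` (`λₙ > 0`, `C'ₙ Cₙ = Cₙ C'ₙ = I`, `Cₙ` inner-product preserving) with `λₙ → 1`, `τₙ ↓ 0`, and
POINTWISE convergent difference quotients `τₙ⁻¹(wₙ(x) − m(x)) → h(x)`.

* `exists_subseq_tendsto_stabiliser` (§2): compactness modulo the stabiliser — along a subsequence the parameters converge to a
  stabiliser element `(1, C₀, C₀', a₀)` (translations cannot escape: the profile vanishes at infinity but `m ≢ 0`).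
* `tendsto_mul_rate` (§1): first-order expansion of the group product at the identity — both partial differentials are the identity, so
  `d⁻¹((e + dΞ + o(d))·(e − dΞ + o(d)) − e) → 0`.
* `slice_core` (§3): THE SLICE. If representatives `Gₖ → e` are distance-minimising in their stabiliser cosets
  (`‖Gₖ − e‖ ≤ ‖Gₖ s − e‖` for every stabiliser element `s`) while `‖Gₖ − e‖/τₖ → ∞` and the `τₖ`-quotients of `Gₖ·m − m` converge
  pointwise, contradiction: the unit directions `(Gₖ − e)/‖Gₖ − e‖` subconverge to a unit tangent `Ξ` killed by the differential of
  the orbit map; `Ξ` exponentiates into the stabiliser (`…SliceGroup`), and the competitor `Gₖ · exp(−‖Gₖ − e‖ Ξ)` beats the minimum.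
* `rate_of_orbit` (§4, the (RATE) statement for single-orbit sequences, in the format of `TangentCone.tangentCone_of_rate`): along a
  subsequence the `w_(φ n)` admit representatives OVER `m` whose difference quotients `τ⁻¹(λ − 1)`, `τ⁻¹(C − I)`, `τ⁻¹(C' − I)`, `τ⁻¹ a`
  converge.

HONEST FRAMING: finite-dimensional analysis about a fixed profile; it does not supply orbit membership (clause (a)), nor item (ii)
(uniform margin); (RATE) for the normalised-maximiser set, `RigidExit`, `LerayFloorGap`, `ProductionEfficiencyDecay` (stmt-22866) and
Navier–Stokes regularity stay OPEN; no summit statement is proved. [folklore]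
-/

-- the problem directory repeats the summit name (`NavierStokesRegularity/NavierStokesRegularity`)
set_option linter.dupNamespace false

noncomputable section

open Set Filter MeasureTheory Topology Function Bornology
open scoped InnerProductSpace RealInnerProductSpace ENNReal NNReal
open Literature.Analysis.FluidPDE

namespace Summit.NavierStokesRegularity.NavierStokesRegularity.Theorems

namespace RigidExit

namespace Slice

open TangentCone OrbitClosed

/-! ## §1 Tools: unbounded sequences, associativity, stabiliser products, the product at the identity -/

/-- A real sequence with no upper bound has a subsequence tending to `+∞`. [folklore] -/
theorem exists_subseq_tendsto_atTop_of_not_bdd {r : ℕ → ℝ} (h : ¬ ∃ R : ℝ, ∀ n, r n ≤ R) :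
    ∃ ψ : ℕ → ℕ, StrictMono ψ ∧ (∀ k : ℕ, (k : ℝ) < r (ψ k)) ∧ Tendsto (fun k => r (ψ k)) atTop atTop := by
  have hfreq : ∀ k : ℕ, ∃ᶠ n in atTop, (k : ℝ) < r n := by
    intro k
    rw [frequently_atTop]
    intro N
    by_contra hcon
    push Not at hcon
    apply h
    refine ⟨k + ∑ i ∈ Finset.range N, |r i|, fun n => ?_⟩
    have hsum : 0 ≤ ∑ i ∈ Finset.range N, |r i| := Finset.sum_nonneg fun i _ => abs_nonneg _
    by_cases hn : N ≤ n
    · have := hcon n hn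
      linarith
    · push Not at hn
      have hle : |r n| ≤ ∑ i ∈ Finset.range N, |r i| :=
        Finset.single_le_sum (f := fun i => |r i|) (fun i _ => abs_nonneg _) (Finset.mem_range.2 hn)
      have hk : (0 : ℝ) ≤ k := Nat.cast_nonneg k
      linarith [le_abs_self (r n)]
  obtain ⟨ψ, hψ, hP⟩ := extraction_forall_of_frequently hfreq
  exact ⟨ψ, hψ, hP, tendsto_atTop_mono (fun k => (hP k).le) tendsto_natCast_atTop_atTop⟩

/-- **The stabiliser is closed under the product.** [folklore] -/
theorem mul_mem_stabiliser {m : EuclideanSpace ℝ (Fin 3) → EuclideanSpace ℝ (Fin 3)} {p q : ℝ × ((EuclideanSpace ℝ (Fin 3) →L[ℝ] EuclideanSpace ℝ (Fin 3)) × ((EuclideanSpace ℝ (Fin 3) →L[ℝ] EuclideanSpace ℝ (Fin 3)) × EuclideanSpace ℝ (Fin 3)))} (hp : p ∈ {q : ℝ × ((EuclideanSpace ℝ (Fin 3) →L[ℝ] EuclideanSpace ℝ (Fin 3)) × ((EuclideanSpace ℝ (Fin 3) →L[ℝ] EuclideanSpace ℝ (Fin 3)) × EuclideanSpace ℝ (Fin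 3))) | q.1 = 1 ∧ (∀ v, q.2.2.1 (q.2.1 v) = v) ∧ (∀ v, q.2.1 (q.2.2.1 v) = v) ∧ (∀ v w : EuclideanSpace ℝ (Fin 3), ⟪q.2.1 v, q.2.1 w⟫_ℝ = ⟪v, w⟫_ℝ) ∧ ∀ x, q.1 • q.2.1 (m (q.1 • q.2.2.1 (x - q.2.2.2))) = m x}) (hq : q ∈ {q : ℝ × ((EuclideanSpace ℝ (Fin 3) →L[ℝ] EuclideanSpace ℝ (Fin 3)) × ((EuclideanSpace ℝ (Fin 3) →L[ℝ] EuclideanSpace ℝ (Fin 3)) × EuclideanSpace ℝ (Fin 3))) | q.1 = 1 ∧ (∀ v, q.2.2.1 (q.2.1 v) = v) ∧ (∀ v, q.2.1 (q.2.2.1 v) = v) ∧ (∀ v w : EuclideanSpace ℝ (Fin 3), ⟪q.2.1 v, q.2.1 w⟫_ℝ = ⟪v, w⟫_ℝ) ∧ ∀ x, q.1 • q.2.1 (m (q.1 • q.2.2.1 (x - q.2.2.2))) = m x}) :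
    (p.1 * q.1, (p.2.1 * q.2.1, (q.2.2.1 * p.2.2.1, p.2.2.2 + p.1⁻¹ • p.2.1 q.2.2.2))) ∈ {q : ℝ × ((EuclideanSpace ℝ (Fin 3) →L[ℝ] EuclideanSpace ℝ (Fin 3)) × ((EuclideanSpace ℝ (Fin 3) →L[ℝ] EuclideanSpace ℝ (Fin 3)) × EuclideanSpace ℝ (Fin 3))) | q.1 = 1 ∧ (∀ v, q.2.2.1 (q.2.1 v) = v) ∧ (∀ v, q.2.1 (q.2.2.1 v) = v) ∧ (∀ v w : EuclideanSpace ℝ (Fin 3), ⟪q.2.1 v, q.2.1 w⟫_ℝ = ⟪v, w⟫_ℝ) ∧ ∀ x, q.1 • q.2.1 (m (q.1 • q.2.2.1 (x - q.2.2.2))) = m x} := by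
  obtain ⟨hp1, hp2, hp3, hp4, hp5⟩ := hp
  obtain ⟨hq1, hq2, hq3, hq4, hq5⟩ := hq
  refine ⟨by rw [hp1, hq1, mul_one], fun v => ?_, fun v => ?_, fun v w => ?_, fun x => ?_⟩
  · simp only [mul_apply_eq_comp, hp2, hq2]
  · simp only [mul_apply_eq_comp, hp3, hq3]
  · simp only [mul_apply_eq_comp, hp4, hq4]
  · have h1 : p.1 ≠ 0 := by rw [hp1]; exact one_ne_zero
    simp only
    rw [orb_comp m h1 q.1 hp2 q.2.1 q.2.2.1 p.2.2.2 q.2.2.2 x, hq5 (p.1 • p.2.2.1 (x - p.2.2.2)), hp5 x]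

/-- **The product is the identity to first order in each factor at the identity**: if `Gₖ, Γₖ → e` with
`dₖ⁻¹(Gₖ − e) → Ξ` and `dₖ⁻¹(Γₖ − e) → −Ξ`, then `dₖ⁻¹(Gₖ Γₖ − e) → 0`. [folklore] -/
theorem tendsto_mul_rate {G Γ : ℕ → ℝ × ((EuclideanSpace ℝ (Fin 3) →L[ℝ] EuclideanSpace ℝ (Fin 3)) × ((EuclideanSpace ℝ (Fin 3) →L[ℝ] EuclideanSpace ℝ (Fin 3)) × EuclideanSpace ℝ (Fin 3)))} {dd : ℕ → ℝ} {Ξ : ℝ × ((EuclideanSpace ℝ (Fin 3) →L[ℝ] EuclideanSpace ℝ (Fin 3)) × ((EuclideanSpace ℝ (Fin 3) →L[ℝ] EuclideanSpace ℝ (Fin 3)) × EuclideanSpace ℝ (Fin 3)))}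
    (hG : Tendsto G atTop (𝓝 ((1 : ℝ), ((1 : (EuclideanSpace ℝ (Fin 3) →L[ℝ] EuclideanSpace ℝ (Fin 3))), ((1 : (EuclideanSpace ℝ (Fin 3) →L[ℝ] EuclideanSpace ℝ (Fin 3))), (0 : EuclideanSpace ℝ (Fin 3))))))) (hΓ : Tendsto Γ atTop (𝓝 ((1 : ℝ), ((1 : (EuclideanSpace ℝ (Fin 3) →L[ℝ] EuclideanSpace ℝ (Fin 3))), ((1 : (EuclideanSpace ℝ (Fin 3) →L[ℝ] EuclideanSpace ℝ (Fin 3))), (0 : EuclideanSpace ℝ (Fin 3)))))))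
    (hP : Tendsto (fun k => (dd k)⁻¹ • (G k - ((1 : ℝ), ((1 : (EuclideanSpace ℝ (Fin 3) →L[ℝ] EuclideanSpace ℝ (Fin 3))), ((1 : (EuclideanSpace ℝ (Fin 3) →L[ℝ] EuclideanSpace ℝ (Fin 3))), (0 : EuclideanSpace ℝ (Fin 3))))))) atTop (𝓝 Ξ))
    (hR : Tendsto (fun k => (dd k)⁻¹ • (Γ k - ((1 : ℝ), ((1 : (EuclideanSpace ℝ (Fin 3) →L[ℝ] EuclideanSpace ℝ (Fin 3))), ((1 : (EuclideanSpace ℝ (Fin 3) →L[ℝ] EuclideanSpace ℝ (Fin 3))), (0 : EuclideanSpace ℝ (Fin 3))))))) atTop (𝓝 (-Ξ))) :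
    Tendsto (fun k => (dd k)⁻¹ • (((G k).1 * (Γ k).1, ((G k).2.1 * (Γ k).2.1, ((Γ k).2.2.1 * (G k).2.2.1, (G k).2.2.2 + (G k).1⁻¹ • (G k).2.1 (Γ k).2.2.2))) - ((1 : ℝ), ((1 : (EuclideanSpace ℝ (Fin 3) →L[ℝ] EuclideanSpace ℝ (Fin 3))), ((1 : (EuclideanSpace ℝ (Fin 3) →L[ℝ] EuclideanSpace ℝ (Fin 3))), (0 : EuclideanSpace ℝ (Fin 3))))))) atTop (𝓝 0) := by
  obtain ⟨σ, A, A', b⟩ := Ξ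
  have hR' : Tendsto (fun k => (dd k)⁻¹ • (Γ k - ((1 : ℝ), ((1 : (EuclideanSpace ℝ (Fin 3) →L[ℝ] EuclideanSpace ℝ (Fin 3))), ((1 : (EuclideanSpace ℝ (Fin 3) →L[ℝ] EuclideanSpace ℝ (Fin 3))), (0 : EuclideanSpace ℝ (Fin 3))))))) atTop (𝓝 ((-σ), ((-A), ((-A'), (-b))))) := by
    simpa only [Prod.neg_mk] using hR
  -- components of the hypotheses
  have hG1 : Tendsto (fun k => (G k).1) atTop (𝓝 1) := (continuous_fst.tendsto _).comp hG
  have hG2 : Tendsto (fun k => (G k).2.1) atTop (𝓝 1) := (continuous_snd.fst.tendsto _).comp hG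
  have hΓ1 : Tendsto (fun k => (Γ k).1) atTop (𝓝 1) := (continuous_fst.tendsto _).comp hΓ
  have hΓ2 : Tendsto (fun k => (Γ k).2.1) atTop (𝓝 1) := (continuous_snd.fst.tendsto _).comp hΓ
  have hΓ3 : Tendsto (fun k => (Γ k).2.2.1) atTop (𝓝 1) := (continuous_snd.snd.fst.tendsto _).comp hΓ
  have hP1 : Tendsto (fun k => (dd k)⁻¹ * ((G k).1 - 1)) atTop (𝓝 σ) := (continuous_fst.tendsto _).comp hP
  have hP2 : Tendsto (fun k => (dd k)⁻¹ • ((G k).2.1 - 1)) atTop (𝓝 A) := (continuous_snd.fst.tendsto _).comp hP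
  have hP3 : Tendsto (fun k => (dd k)⁻¹ • ((G k).2.2.1 - 1)) atTop (𝓝 A') := (continuous_snd.snd.fst.tendsto _).comp hP
  have hP4 : Tendsto (fun k => (dd k)⁻¹ • ((G k).2.2.2 - 0)) atTop (𝓝 b) := (continuous_snd.snd.snd.tendsto _).comp hP
  have hR1 : Tendsto (fun k => (dd k)⁻¹ * ((Γ k).1 - 1)) atTop (𝓝 (-σ)) := (continuous_fst.tendsto _).comp hR'
  have hR2 : Tendsto (fun k => (dd k)⁻¹ • ((Γ k).2.1 - 1)) atTop (𝓝 (-A)) := (continuous_snd.fst.tendsto _).comp hR'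
  have hR3 : Tendsto (fun k => (dd k)⁻¹ • ((Γ k).2.2.1 - 1)) atTop (𝓝 (-A')) := (continuous_snd.snd.fst.tendsto _).comp hR'
  have hR4 : Tendsto (fun k => (dd k)⁻¹ • ((Γ k).2.2.2 - 0)) atTop (𝓝 (-b)) := (continuous_snd.snd.snd.tendsto _).comp hR'
  -- component 1
  have c1 : Tendsto (fun k => (dd k)⁻¹ * ((G k).1 * (Γ k).1 - 1)) atTop (𝓝 0) := by
    have h := (hP1.mul hΓ1).add hR1
    rw [mul_one, add_neg_cancel] at h
    refine h.congr fun k => ?_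
    ring
  -- component 2
  have c2 : Tendsto (fun k => (dd k)⁻¹ • ((G k).2.1 * (Γ k).2.1 - 1)) atTop (𝓝 0) := by
    have h := (hP2.mul hΓ2).add hR2
    rw [mul_one, add_neg_cancel] at h
    refine h.congr fun k => ?_
    refine ContinuousLinearMap.ext fun v => ?_
    simp only [smul_apply, sub_apply, add_apply, mul_apply_eq_comp, one_apply_eq_self, smul_sub]
    rw [sub_add_sub_cancel]
  -- component 3
  have c3 : Tendsto (fun k => (dd k)⁻¹ • ((Γ k).2.2.1 * (G k).2.2.1 - 1)) atTop (𝓝 0) := by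
    have h := (hΓ3.mul hP3).add hR3
    rw [one_mul, add_neg_cancel] at h
    refine h.congr fun k => ?_
    refine ContinuousLinearMap.ext fun v => ?_
    simp only [smul_apply, sub_apply, add_apply, mul_apply_eq_comp, one_apply_eq_self, smul_sub, map_smul, map_sub]
    rw [sub_add_sub_cancel]
  -- component 4
  have c4 : Tendsto (fun k => (dd k)⁻¹ • ((G k).2.2.2 + (G k).1⁻¹ • (G k).2.1 (Γ k).2.2.2 - 0)) atTop (𝓝 0) := by
    have h := hP4.add (((hG1.inv₀ one_ne_zero).smul (tendsto_clm_apply hG2 hR4)))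
    rw [inv_one, one_smul, one_apply_eq_self, add_neg_cancel] at h
    refine h.congr fun k => ?_
    simp only [sub_zero, smul_add, map_smul]
    rw [smul_comm]
  have h := c1.prodMk_nhds (c2.prodMk_nhds (c3.prodMk_nhds c4))
  exact h.congr fun k => rfl

/-! ## §2 Compactness modulo the stabiliser -/

/-- **Parameters of orbit points converging pointwise to the profile subconverge to a stabiliser element.** For a continuous profile
`m` vanishing at infinity with `m x₀ ≠ 0`: if `λₙ Cₙ m(λₙ C'ₙ(x − aₙ)) → m(x)` for every `x` and `λₙ → 1`, then along a subsequence
`Cₙ → C₀`, `C'ₙ → C₀'`, `aₙ → a₀` with `(1, C₀, C₀', a₀)` in the stabiliser. [folklore] -/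
theorem exists_subseq_tendsto_stabiliser {m : EuclideanSpace ℝ (Fin 3) → EuclideanSpace ℝ (Fin 3)} (hmc : Continuous m)
    (hm0 : Tendsto m (cocompact (EuclideanSpace ℝ (Fin 3))) (𝓝 0)) {x₀ : EuclideanSpace ℝ (Fin 3)} (hx₀ : m x₀ ≠ 0)
    {lam : ℕ → ℝ} {C C' : ℕ → (EuclideanSpace ℝ (Fin 3) →L[ℝ] EuclideanSpace ℝ (Fin 3))} {a : ℕ → EuclideanSpace ℝ (Fin 3)} (hlam : ∀ n, 0 < lam n)
    (hinv : ∀ n v, C' n (C n v) = v) (hinv' : ∀ n v, C n (C' n v) = v)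
    (hiso : ∀ n (v w : EuclideanSpace ℝ (Fin 3)), ⟪C n v, C n w⟫_ℝ = ⟪v, w⟫_ℝ) (hlam1 : Tendsto lam atTop (𝓝 1))
    (hptw : ∀ x, Tendsto (fun n => lam n • C n (m (lam n • C' n (x - a n)))) atTop (𝓝 (m x))) :
    ∃ (φ : ℕ → ℕ) (C₀ C₀' : (EuclideanSpace ℝ (Fin 3) →L[ℝ] EuclideanSpace ℝ (Fin 3))) (a₀ : EuclideanSpace ℝ (Fin 3)), StrictMono φ ∧ (∀ v, C₀' (C₀ v) = v) ∧ (∀ v, C₀ (C₀' v) = v) ∧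
      (∀ v w : EuclideanSpace ℝ (Fin 3), ⟪C₀ v, C₀ w⟫_ℝ = ⟪v, w⟫_ℝ) ∧ (∀ x, C₀ (m (C₀' (x - a₀))) = m x) ∧
      Tendsto (fun n => C (φ n)) atTop (𝓝 C₀) ∧ Tendsto (fun n => C' (φ n)) atTop (𝓝 C₀') ∧
      Tendsto (fun n => a (φ n)) atTop (𝓝 a₀) := by
  -- translations are bounded
  have hbd : ∃ r : ℝ, ∀ n, ‖a n‖ ≤ r := by
    by_contra hb
    obtain ⟨ψ, hψ, hnorm⟩ := exists_subseq_norm_tendsto_atTop hb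
    have hlψ : Tendsto (fun k => lam (ψ k)) atTop (𝓝 1) := hlam1.comp hψ.tendsto_atTop
    set y : ℕ → EuclideanSpace ℝ (Fin 3) := fun k => lam (ψ k) • C' (ψ k) (x₀ - a (ψ k)) with hy
    have hny : ∀ k, ‖y k‖ = lam (ψ k) * ‖x₀ - a (ψ k)‖ := fun k => by
      simp only [hy, norm_smul, norm_map_inv (hinv' (ψ k)) (hiso (ψ k)), Real.norm_eq_abs, abs_of_pos (hlam _)]
    have hdiff : Tendsto (fun k => ‖x₀ - a (ψ k)‖) atTop atTop := by
      have h1 : ∀ k, ‖a (ψ k)‖ - ‖x₀‖ ≤ ‖x₀ - a (ψ k)‖ := fun k => by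
        have := norm_sub_norm_le (a (ψ k)) x₀
        rw [norm_sub_rev] at this
        linarith
      refine tendsto_atTop_mono h1 ?_
      exact (tendsto_atTop_add_const_right _ (-‖x₀‖) hnorm).congr fun k => by ring
    have hyn : Tendsto (fun k => ‖y k‖) atTop atTop := by
      have := hlψ.pos_mul_atTop one_pos hdiff
      exact this.congr fun k => (hny k).symm
    have hyco : Tendsto y atTop (cocompact (EuclideanSpace ℝ (Fin 3))) := by
      rw [← Metric.cobounded_eq_cocompact]
      exact tendsto_norm_atTop_iff_cobounded.1 hyn
    have hmy : Tendsto (fun k => m (y k)) atTop (𝓝 0) := hm0.comp hyco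
    have hux : Tendsto (fun k => lam (ψ k) • C (ψ k) (m (lam (ψ k) • C' (ψ k) (x₀ - a (ψ k))))) atTop (𝓝 0) := by
      have h1 : Tendsto (fun k => ‖lam (ψ k) • C (ψ k) (m (lam (ψ k) • C' (ψ k) (x₀ - a (ψ k))))‖) atTop (𝓝 0) := by
        have h2 : ∀ k, ‖lam (ψ k) • C (ψ k) (m (lam (ψ k) • C' (ψ k) (x₀ - a (ψ k))))‖ = lam (ψ k) * ‖m (y k)‖ := fun k => by
          simp only [hy, norm_smul, norm_map_of_inner (hiso (ψ k)), Real.norm_eq_abs, abs_of_pos (hlam _)]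
        have h3 : Tendsto (fun k => lam (ψ k) * ‖m (y k)‖) atTop (𝓝 (1 * 0)) := hlψ.mul (tendsto_zero_iff_norm_tendsto_zero.1 hmy)
        rw [mul_zero] at h3
        exact h3.congr fun k => (h2 k).symm
      exact tendsto_zero_iff_norm_tendsto_zero.2 h1
    exact hx₀ (tendsto_nhds_unique ((hptw x₀).comp hψ.tendsto_atTop) hux)
  obtain ⟨r, hr⟩ := hbd
  -- the triples `(Cₙ, C'ₙ, aₙ)` live in a bounded set
  set P : ℕ → (EuclideanSpace ℝ (Fin 3) →L[ℝ] EuclideanSpace ℝ (Fin 3)) × ((EuclideanSpace ℝ (Fin 3) →L[ℝ] EuclideanSpace ℝ (Fin 3)) × EuclideanSpace ℝ (Fin 3)) := fun n => (C n, (C' n, a n)) with hP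
  have hmem : ∀ n, P n ∈ Metric.closedBall (0 : (EuclideanSpace ℝ (Fin 3) →L[ℝ] EuclideanSpace ℝ (Fin 3)) × ((EuclideanSpace ℝ (Fin 3) →L[ℝ] EuclideanSpace ℝ (Fin 3)) × EuclideanSpace ℝ (Fin 3))) (max 1 r) := by
    intro n
    rw [Metric.mem_closedBall, dist_zero_right, Prod.norm_def, Prod.norm_def]
    exact max_le ((opNorm_le_one_of_inner (hiso n)).trans (le_max_left _ _))
      (max_le ((opNorm_le_one_of_inner (inner_map_inv (hinv' n) (hiso n))).trans (le_max_left _ _)) ((hr n).trans (le_max_right _ _)))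
  obtain ⟨⟨C₀, C₀', a₀⟩, -, φ, hφ, hlim⟩ := tendsto_subseq_of_bounded Metric.isBounded_closedBall hmem
  have hC : Tendsto (fun n => C (φ n)) atTop (𝓝 C₀) := (continuous_fst.tendsto _).comp hlim
  have hC' : Tendsto (fun n => C' (φ n)) atTop (𝓝 C₀') := (continuous_snd.fst.tendsto _).comp hlim
  have ha : Tendsto (fun n => a (φ n)) atTop (𝓝 a₀) := (continuous_snd.snd.tendsto _).comp hlim
  have hlφ : Tendsto (fun n => lam (φ n)) atTop (𝓝 1) := hlam1.comp hφ.tendsto_atTop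
  refine ⟨φ, C₀, C₀', a₀, hφ, fun v => ?_, fun v => ?_, fun v w => ?_, fun x => ?_, hC, hC', ha⟩
  · have h1 := tendsto_clm_apply hC' (tendsto_clm_apply hC (tendsto_const_nhds (x := v)))
    have h2 : (fun n => C' (φ n) (C (φ n) v)) = fun _ => v := funext fun n => hinv (φ n) v
    rw [h2] at h1
    exact tendsto_nhds_unique h1 tendsto_const_nhds
  · have h1 := tendsto_clm_apply hC (tendsto_clm_apply hC' (tendsto_const_nhds (x := v)))
    have h2 : (fun n => C (φ n) (C' (φ n) v)) = fun _ => v := funext fun n => hinv' (φ n) v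
    rw [h2] at h1
    exact tendsto_nhds_unique h1 tendsto_const_nhds
  · have h1 := Filter.Tendsto.inner (𝕜 := ℝ) (tendsto_clm_apply hC (tendsto_const_nhds (x := v)))
      (tendsto_clm_apply hC (tendsto_const_nhds (x := w)))
    have h2 : (fun n => ⟪C (φ n) v, C (φ n) w⟫_ℝ) = fun _ => ⟪v, w⟫_ℝ := funext fun n => hiso (φ n) v w
    rw [h2] at h1
    exact tendsto_nhds_unique h1 tendsto_const_nhds
  · have hin : Tendsto (fun n => lam (φ n) • C' (φ n) (x - a (φ n))) atTop (𝓝 ((1 : ℝ) • C₀' (x - a₀))) :=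
      hlφ.smul (tendsto_clm_apply hC' (tendsto_const_nhds.sub ha))
    have hout : Tendsto (fun n => lam (φ n) • C (φ n) (m (lam (φ n) • C' (φ n) (x - a (φ n))))) atTop
        (𝓝 ((1 : ℝ) • C₀ (m ((1 : ℝ) • C₀' (x - a₀))))) := hlφ.smul (tendsto_clm_apply hC ((hmc.tendsto _).comp hin))
    rw [one_smul, one_smul] at hout
    exact tendsto_nhds_unique hout ((hptw x).comp hφ.tendsto_atTop)

/-! ## §3 The slice -/

/-- **THE COMPACT-STABILISER SLICE (core contradiction).** Let `m` be a continuous, differentiable profile vanishing at infinity with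
`m x₀ ≠ 0`, and `Gₖ → e` group elements that are distance-minimising in their stabiliser cosets (`‖Gₖ − e‖ ≤ ‖Gₖ s − e‖` for every
stabiliser element `s`), with `‖Gₖ − e‖ > 0` and `‖Gₖ − e‖/Tₖ → ∞` for some `Tₖ > 0`. Then the `Tₖ`-difference quotients of
`Gₖ·m − m` cannot converge at every point. Mechanism: unit directions `(Gₖ − e)/‖Gₖ − e‖` subconverge to a unit tangent `Ξ` at the
identity killed by the differential of the orbit map; `Ξ` exponentiates into the stabiliser (`…SliceGroup`); the competitor
`Gₖ · exp(−‖Gₖ − e‖ Ξ)` is `o(‖Gₖ − e‖)`-close to `e`, beating the minimum. [folklore] -/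
theorem slice_core {m : EuclideanSpace ℝ (Fin 3) → EuclideanSpace ℝ (Fin 3)} (hmc : Continuous m) (hmd : Differentiable ℝ m)
    (hm0 : Tendsto m (cocompact (EuclideanSpace ℝ (Fin 3))) (𝓝 0)) {x₀ : EuclideanSpace ℝ (Fin 3)} (hx₀ : m x₀ ≠ 0)
    {G : ℕ → ℝ × ((EuclideanSpace ℝ (Fin 3) →L[ℝ] EuclideanSpace ℝ (Fin 3)) × ((EuclideanSpace ℝ (Fin 3) →L[ℝ] EuclideanSpace ℝ (Fin 3)) × EuclideanSpace ℝ (Fin 3)))} (hGinv : ∀ k v, (G k).2.2.1 ((G k).2.1 v) = v)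
    (hGiso : ∀ k (v w : EuclideanSpace ℝ (Fin 3)), ⟪(G k).2.1 v, (G k).2.1 w⟫_ℝ = ⟪v, w⟫_ℝ)
    (hGe : Tendsto G atTop (𝓝 ((1 : ℝ), ((1 : (EuclideanSpace ℝ (Fin 3) →L[ℝ] EuclideanSpace ℝ (Fin 3))), ((1 : (EuclideanSpace ℝ (Fin 3) →L[ℝ] EuclideanSpace ℝ (Fin 3))), (0 : EuclideanSpace ℝ (Fin 3))))))) (hpos : ∀ k, 0 < ‖G k - ((1 : ℝ), ((1 : (EuclideanSpace ℝ (Fin 3) →L[ℝ] EuclideanSpace ℝ (Fin 3))), ((1 : (EuclideanSpace ℝ (Fin 3) →L[ℝ] EuclideanSpace ℝ (Fin 3))), (0 : EuclideanSpace ℝ (Fin 3)))))‖)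
    (hmin : ∀ k, ∀ s ∈ {q : ℝ × ((EuclideanSpace ℝ (Fin 3) →L[ℝ] EuclideanSpace ℝ (Fin 3)) × ((EuclideanSpace ℝ (Fin 3) →L[ℝ] EuclideanSpace ℝ (Fin 3)) × EuclideanSpace ℝ (Fin 3))) | q.1 = 1 ∧ (∀ v, q.2.2.1 (q.2.1 v) = v) ∧ (∀ v, q.2.1 (q.2.2.1 v) = v) ∧ (∀ v w : EuclideanSpace ℝ (Fin 3), ⟪q.2.1 v, q.2.1 w⟫_ℝ = ⟪v, w⟫_ℝ) ∧ ∀ x, q.1 • q.2.1 (m (q.1 • q.2.2.1 (x - q.2.2.2))) = m x}, ‖G k - ((1 : ℝ), ((1 : (EuclideanSpace ℝ (Fin 3) →L[ℝ] EuclideanSpace ℝ (Fin 3))), ((1 : (EuclideanSpace ℝ (Fin 3) →L[ℝ] EuclideanSpace ℝ (Fin 3))), (0 : EuclideanSpace ℝ (Fin 3)))))‖ ≤ ‖((G k).1 * s.1, ((G k).2.1 * s.2.1, (s.2.2.1 * (G k).2.2.1, (G k).2.2.2 + (G k).1⁻¹ • (G k).2.1 s.2.2.2))) - ((1 : ℝ),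 ((1 : (EuclideanSpace ℝ (Fin 3) →L[ℝ] EuclideanSpace ℝ (Fin 3))), ((1 : (EuclideanSpace ℝ (Fin 3) →L[ℝ] EuclideanSpace ℝ (Fin 3))), (0 : EuclideanSpace ℝ (Fin 3)))))‖)
    {T : ℕ → ℝ} (hT : ∀ k, 0 < T k) (hrate : Tendsto (fun k => (T k)⁻¹ * ‖G k - ((1 : ℝ), ((1 : (EuclideanSpace ℝ (Fin 3) →L[ℝ] EuclideanSpace ℝ (Fin 3))), ((1 : (EuclideanSpace ℝ (Fin 3) →L[ℝ] EuclideanSpace ℝ (Fin 3))), (0 : EuclideanSpace ℝ (Fin 3)))))‖) atTop atTop)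
    {h : EuclideanSpace ℝ (Fin 3) → EuclideanSpace ℝ (Fin 3)}
    (hh : ∀ x, Tendsto (fun k => (T k)⁻¹ • ((G k).1 • (G k).2.1 (m ((G k).1 • (G k).2.2.1 (x - (G k).2.2.2))) - m x)) atTop
      (𝓝 (h x))) : False := by
  set e : ℝ × ((EuclideanSpace ℝ (Fin 3) →L[ℝ] EuclideanSpace ℝ (Fin 3)) × ((EuclideanSpace ℝ (Fin 3) →L[ℝ] EuclideanSpace ℝ (Fin 3)) × EuclideanSpace ℝ (Fin 3))) := ((1 : ℝ), ((1 : (EuclideanSpace ℝ (Fin 3) →L[ℝ] EuclideanSpace ℝ (Fin 3))), ((1 : (EuclideanSpace ℝ (Fin 3) →L[ℝ] EuclideanSpace ℝ (Fin 3))), (0 : EuclideanSpace ℝ (Fin 3))))) with he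
  set dd : ℕ → ℝ := fun k => ‖G k - e‖ with hdd
  -- unit directions subconverge
  set U : ℕ → ℝ × ((EuclideanSpace ℝ (Fin 3) →L[ℝ] EuclideanSpace ℝ (Fin 3)) × ((EuclideanSpace ℝ (Fin 3) →L[ℝ] EuclideanSpace ℝ (Fin 3)) × EuclideanSpace ℝ (Fin 3))) := fun k => (dd k)⁻¹ • (G k - e) with hU
  have hUn : ∀ k, ‖U k‖ = 1 := fun k => by
    rw [hU, norm_smul, norm_inv, Real.norm_of_nonneg (hpos k).le]
    exact inv_mul_cancel₀ (hpos k).ne'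
  obtain ⟨⟨σ, A, A', b⟩, -, φ, hφ, hlimU⟩ := tendsto_subseq_of_bounded (Metric.isBounded_closedBall (x := (0 : ℝ × ((EuclideanSpace ℝ (Fin 3) →L[ℝ] EuclideanSpace ℝ (Fin 3)) × ((EuclideanSpace ℝ (Fin 3) →L[ℝ] EuclideanSpace ℝ (Fin 3)) × EuclideanSpace ℝ (Fin 3))))) (r := 1))
    (x := U) (fun k => by rw [Metric.mem_closedBall, dist_zero_right, hUn k])
  have hΞn : ‖((σ, (A, (A', b))) : ℝ × ((EuclideanSpace ℝ (Fin 3) →L[ℝ] EuclideanSpace ℝ (Fin 3)) × ((EuclideanSpace ℝ (Fin 3) →L[ℝ] EuclideanSpace ℝ (Fin 3)) × EuclideanSpace ℝ (Fin 3))))‖ = 1 := by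
    have h1 := hlimU.norm
    have h2 : (fun k => ‖(U ∘ φ) k‖) = fun _ => (1 : ℝ) := funext fun k => hUn (φ k)
    rw [h2] at h1
    exact tendsto_nhds_unique h1 tendsto_const_nhds
  -- rates along the subsequence
  have hGe' : Tendsto (fun k => G (φ k)) atTop (𝓝 e) := hGe.comp hφ.tendsto_atTop
  have hdd0 : Tendsto (fun k => dd (φ k)) atTop (𝓝 0) := by
    have := (tendsto_iff_norm_sub_tendsto_zero.1 hGe').comp tendsto_id
    simpa [hdd] using (tendsto_iff_norm_sub_tendsto_zero.1 hGe')
  have hddne : ∀ k, dd (φ k) ≠ 0 := fun k => (hpos (φ k)).ne'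
  have hratio : Tendsto (fun k => (dd (φ k))⁻¹ * T (φ k)) atTop (𝓝 0) := by
    have h1 := (hrate.comp hφ.tendsto_atTop).inv_tendsto_atTop
    refine h1.congr fun k => ?_
    simp only [Function.comp_apply, Pi.inv_apply, mul_inv, inv_inv, hdd, mul_comm]
  have hP : Tendsto (fun k => (dd (φ k))⁻¹ • (G (φ k) - e)) atTop (𝓝 (σ, (A, (A', b)))) := hlimU
  -- the differential of the orbit map kills `Ξ`
  have hzero : ∀ x : EuclideanSpace ℝ (Fin 3), fderiv ℝ (fun q : ℝ × ((EuclideanSpace ℝ (Fin 3) →L[ℝ] EuclideanSpace ℝ (Fin 3)) × ((EuclideanSpace ℝ (Fin 3) →L[ℝ] EuclideanSpace ℝ (Fin 3)) × EuclideanSpace ℝ (Fin 3))) => q.1 • q.2.1 (m (q.1 • q.2.2.1 (x - q.2.2.2)))) e (σ, (A, (A', b))) = 0 := by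
    intro x
    set F : ℝ × ((EuclideanSpace ℝ (Fin 3) →L[ℝ] EuclideanSpace ℝ (Fin 3)) × ((EuclideanSpace ℝ (Fin 3) →L[ℝ] EuclideanSpace ℝ (Fin 3)) × EuclideanSpace ℝ (Fin 3))) → EuclideanSpace ℝ (Fin 3) := fun q => q.1 • q.2.1 (m (q.1 • q.2.2.1 (x - q.2.2.2))) with hF
    have hFd : HasFDerivAt F (fderiv ℝ F e) e := (differentiableAt_orbitParam hmd x e).hasFDerivAt
    have hd0 : Tendsto (fun k => G (φ k) - e) atTop (𝓝 0) := by
      have := hGe'.sub_const e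
      rwa [sub_self] at this
    have lim2 := tendsto_smul_sub_of_hasFDerivAt hFd hd0 hP
    have lim2' : Tendsto (fun k => (dd (φ k))⁻¹ • (F (G (φ k)) - F e)) atTop (𝓝 (fderiv ℝ F e (σ, (A, (A', b))))) := by
      refine lim2.congr fun k => ?_
      rw [add_sub_cancel]
    have hFe : F e = m x := by simp [hF, he]
    have lim1 : Tendsto (fun k => (dd (φ k))⁻¹ • (F (G (φ k)) - F e)) atTop (𝓝 0) := by
      simp only [hFe]
      have h1 := hratio.smul ((hh x).comp hφ.tendsto_atTop)
      rw [zero_smul] at h1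
      refine h1.congr fun k => ?_
      simp only [Function.comp_apply, hF, smul_smul]
      congr 1
      rw [mul_assoc, mul_inv_cancel₀ (hT (φ k)).ne', mul_one]
    exact tendsto_nhds_unique lim2' lim1
  -- `Ξ` is tangent to the group: `A' = -A`, `A` skew
  have hC : Tendsto (fun k => (dd (φ k))⁻¹ • ((G (φ k)).2.1 - ContinuousLinearMap.id ℝ (EuclideanSpace ℝ (Fin 3)))) atTop (𝓝 A) :=
    (continuous_snd.fst.tendsto _).comp hP
  have hC' : Tendsto (fun k => (dd (φ k))⁻¹ • ((G (φ k)).2.2.1 - ContinuousLinearMap.id ℝ (EuclideanSpace ℝ (Fin 3)))) atTop (𝓝 A') :=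
    (continuous_snd.snd.fst.tendsto _).comp hP
  have hneg := inv_rate_eq_neg (C := fun k => (G (φ k)).2.1) (C' := fun k => (G (φ k)).2.2.1) hddne hdd0
    (fun k v => hGinv (φ k) v) hC hC'
  have hskew := skew_of_isometry_rate (C := fun k => (G (φ k)).2.1) hddne hdd0 (fun k v w => hGiso (φ k) v w) hC
  have hA' : A' = -A := ContinuousLinearMap.ext fun v => by rw [hneg v]; rfl
  subst hA'
  -- the one-parameter subgroup with velocity `Ξ` lies in the stabiliser
  obtain ⟨lamc, Cc, Cc', ac, hl0, hC0, hC'0, ha0, hlpos, hinvc, hinvc', hisoc, hml, hmC, hmC', hma, hdl, hdC, hdC', hda⟩ :=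
    exists_oneParam σ hskew b
  have hfix : ∀ (t : ℝ) (x : EuclideanSpace ℝ (Fin 3)), lamc t • Cc t (m (lamc t • Cc' t (x - ac t))) = m x :=
    orbit_const_of_fderiv_zero hmd hl0 hC0 hC'0 ha0 hlpos hinvc hml hmC hmC' hma hdl hdC hdC' hda hzero
  have hl1 : ∀ t, lamc t = 1 := fun t => scale_eq_one hmc hm0 hx₀ (hlpos t) (hinvc t) (hisoc t) (hfix t)
  have hγS : ∀ t, ((lamc t, (Cc t, (Cc' t, ac t))) : ℝ × ((EuclideanSpace ℝ (Fin 3) →L[ℝ] EuclideanSpace ℝ (Fin 3)) × ((EuclideanSpace ℝ (Fin 3) →L[ℝ] EuclideanSpace ℝ (Fin 3)) × EuclideanSpace ℝ (Fin 3)))) ∈ {q : ℝ × ((EuclideanSpace ℝ (Fin 3) →L[ℝ] EuclideanSpace ℝ (Fin 3)) × ((EuclideanSpace ℝ (Fin 3) →L[ℝ] EuclideanSpace ℝ (Fin 3)) × EuclideanSpace ℝ (Fin 3))) | q.1 = 1 ∧ (∀ v, q.2.2.1 (q.2.1 v) = v) ∧ (∀ v, q.2.1 (q.2.2.1 v) =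 v) ∧ (∀ v w : EuclideanSpace ℝ (Fin 3), ⟪q.2.1 v, q.2.1 w⟫_ℝ = ⟪v, w⟫_ℝ) ∧ ∀ x, q.1 • q.2.1 (m (q.1 • q.2.2.1 (x - q.2.2.2))) = m x} :=
    fun t => ⟨hl1 t, hinvc t, hinvc' t, hisoc t, hfix t⟩
  -- the competitor
  set γ : ℝ → ℝ × ((EuclideanSpace ℝ (Fin 3) →L[ℝ] EuclideanSpace ℝ (Fin 3)) × ((EuclideanSpace ℝ (Fin 3) →L[ℝ] EuclideanSpace ℝ (Fin 3)) × EuclideanSpace ℝ (Fin 3))) := fun t => (lamc t, (Cc t, (Cc' t, ac t))) with hγ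
  have hγd : HasDerivAt γ (σ, (A, (-A, b))) 0 := hdl.prodMk (hdC.prodMk (hdC'.prodMk hda))
  have hγ0 : γ 0 = e := by simp [hγ, he, hl0, hC0, hC'0, ha0]
  set Γ : ℕ → ℝ × ((EuclideanSpace ℝ (Fin 3) →L[ℝ] EuclideanSpace ℝ (Fin 3)) × ((EuclideanSpace ℝ (Fin 3) →L[ℝ] EuclideanSpace ℝ (Fin 3)) × EuclideanSpace ℝ (Fin 3))) := fun k => γ (-dd (φ k)) with hΓ
  have hΓe : Tendsto Γ atTop (𝓝 e) := by
    have h1 : Tendsto (fun k => -dd (φ k)) atTop (𝓝 0) := by simpa using hdd0.neg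
    have h2 := (hγd.continuousAt.tendsto).comp h1
    rwa [hγ0] at h2
  have hR : Tendsto (fun k => (dd (φ k))⁻¹ • (Γ k - e)) atTop (𝓝 (-(σ, (A, (-A, b))))) := by
    have h1 : Tendsto (fun k => -dd (φ k)) atTop (𝓝[≠] 0) := by
      refine tendsto_nhdsWithin_iff.2 ⟨by simpa using hdd0.neg, Eventually.of_forall fun k => ?_⟩
      rw [Set.mem_compl_iff, Set.mem_singleton_iff, neg_eq_zero]
      exact hddne k
    have h2 := (hγd.tendsto_slope_zero.comp h1).neg
    refine h2.congr fun k => ?_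
    simp only [Function.comp_apply, zero_add, hγ0, inv_neg, neg_smul, neg_neg, hΓ]
  have hmulrate := tendsto_mul_rate hGe' hΓe hP hR
  -- the competitor beats the minimum
  have hle : ∀ k, (1 : ℝ) ≤ ‖(dd (φ k))⁻¹ • (((G (φ k)).1 * (Γ k).1, ((G (φ k)).2.1 * (Γ k).2.1, ((Γ k).2.2.1 * (G (φ k)).2.2.1, (G (φ k)).2.2.2 + (G (φ k)).1⁻¹ • (G (φ k)).2.1 (Γ k).2.2.2))) - e)‖ := by
    intro k
    have h1 := hmin (φ k) (Γ k) (hγS _)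
    rw [norm_smul, norm_inv, Real.norm_of_nonneg (hpos (φ k)).le]
    have h2 : (dd (φ k))⁻¹ * dd (φ k) = 1 := inv_mul_cancel₀ (hddne k)
    rw [← h2]
    exact mul_le_mul_of_nonneg_left h1 (inv_nonneg.2 (hpos (φ k)).le)
  have hlt : ∀ᶠ k in atTop, ‖(dd (φ k))⁻¹ • (((G (φ k)).1 * (Γ k).1, ((G (φ k)).2.1 * (Γ k).2.1, ((Γ k).2.2.1 * (G (φ k)).2.2.1, (G (φ k)).2.2.2 + (G (φ k)).1⁻¹ • (G (φ k)).2.1 (Γ k).2.2.2))) - e)‖ < 1 := by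
    have h1 := hmulrate.norm
    rw [norm_zero] at h1
    exact (tendsto_order.1 h1).2 1 one_pos
  obtain ⟨k, hk⟩ := hlt.exists
  exact absurd (hle k) (not_le.2 hk)


end Slice

end RigidExit

end Summit.NavierStokesRegularity.NavierStokesRegularity.Theorems
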